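import Summits.AtomisticToContinuum.HydrodynamicLimit.Theorems.EnskogAdjointDualityAdjointEnskogTestFamilyRCorrectorSlice
import HarnessLib

/-!
# K2R corrector balance IV: the registered statement `stub_correctorBalance`

Route `EnskogAdjointDuality` of `AtomisticToContinuum/HydrodynamicLimit`, crux `AdjointEnskogTestFamilyR`
(stmt-AtomisticToContinuum-11592, "K2R"), line `birth`, stub `stub_correctorBalance` (B4): the corrector `κ` of
the test family `φ^N = ψ^N + κ^N/λ_N` pairs to `O(ε)` with the test-side Enskog operator against the Euler
local Maxwellian `f = ρ₀ M_{1,θ₀,u₀}` (local detailed balance: the `λ_N` of the operator cancels the `1/λ_N`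
of the corrector, and the equal-position bracket integrates to zero).

`stub_correctorBalance` is EXACTLY the registered Prop `CorrectorBalance` of the skeleton
`Cruxes/AdjointEnskogTestFamilyR/Lines/birth.lean`: for backgrounds `(ρ₀, θ₀, u₀)` in a compact parameter
range with Lipschitz constant `Lb`, bounded continuous contact factors `Y` and correctors `κ` of quadratic
growth / weighted-Lipschitz constant `C`,
`|∫_{𝕋³} ∫ f ∫_{S²} ∫ ((v−w)·ω)₊ Y f(x+εω,w) [κ(x,v′) + κ(x+εω,w′) − κ(x,v) − κ(x+εω,w)]| ≤ K C ε` for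
`0 ≤ ε ≤ 1`, `K = K(ρm, R, θm, Θ, U, Lb, Ȳ)`.  Proof: `k2r_corrector_slice` at `(θ₀(x), u₀(x))`,
`(θ₀(x+εω), u₀(x+εω))`, `κ(x,·)`, `κ(x+εω,·)`, `d = dist(x, x+εω) ≤ ε`; then `k2r_corrector_position` and the
`x`-integral over the probability space `𝕋³`.

References: C. Cercignani, R. Illner, M. Pulvirenti, *The Mathematical Theory of Dilute Gases* (1994), §3.1
(collision kinematics, detailed balance) [CIP1994].
-/

noncomputable section

open MeasureTheory ProbabilityTheory Metric Set Filter Topology Function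
open scoped InnerProductSpace ENNReal

namespace Summit.AtomisticToContinuum.HydrodynamicLimit.Theorems.EnskogAdjointDuality

open Literature.Analysis.FluidPDE Literature.MathematicalPhysics.KineticTheory

/-! ## The registered statement -/

/-- **Corrector balance (stub B4 of the K2R line `birth`).** Along a Lipschitz background
`(ρ₀, θ₀, u₀)` with values in a compact parameter range (`ρ₀ ∈ [ρm, R]`, `θ₀ ∈ [θm, Θ]`, `‖u₀‖ ≤ U`,
Lipschitz constant `Lb`), a bounded continuous contact factor `Y(x, ω)` (`|Y| ≤ Ȳ`) and a corrector
`κ(x, v)` of quadratic velocity growth and weighted Lipschitz constant `C`, the corrector paired with the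
test-side Enskog operator against the local Maxwellian `f = ρ₀ M_{1,θ₀,u₀}`,
`∫_{𝕋³} ∫ f(x,v) ∫_{S²} ∫ ((v−w)·ω)₊ Y(x,ω) f(x+εω, w) [κ(x,v′) + κ(x+εω,w′) − κ(x,v) − κ(x+εω,w)] dw dσ(ω) dv dx`,
is `≤ K C ε` in absolute value for `0 ≤ ε ≤ 1`, with `K = K(ρm, R, θm, Θ, U, Lb, Ȳ)`: at `ε = 0` it vanishes
by local detailed balance (the bracket identity for one Maxwellian and one velocity function), and moving
the partner point from `x + εω` back to `x` costs `O(ε)` through the Lipschitz bounds and the Gaussian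
coupling of the two Maxwellians (`k2r_corrector_slice`, `k2r_corrector_position`). [cite: CIP1994, §3.1] -/
theorem stub_correctorBalance :
  ∀ (ρm R θm Θ U Lb Yb : ℝ), 0 < ρm → 0 < θm → ∃ K : ℝ, 0 ≤ K ∧
    ∀ (ρ₀ θ₀ : UnitAddTorus (Fin 3) → ℝ) (u₀ : UnitAddTorus (Fin 3) → EuclideanSpace ℝ (Fin 3)),
    Continuous ρ₀ → Continuous θ₀ → Continuous u₀ →
    (∀ x, ρm ≤ ρ₀ x ∧ ρ₀ x ≤ R) → (∀ x, θm ≤ θ₀ x ∧ θ₀ x ≤ Θ) → (∀ x, ‖u₀ x‖ ≤ U) →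
    (∀ x x', |ρ₀ x - ρ₀ x'| ≤ Lb * dist x x' ∧ |θ₀ x - θ₀ x'| ≤ Lb * dist x x' ∧ ‖u₀ x - u₀ x'‖ ≤ Lb * dist x x') →
    ∀ (Yf : UnitAddTorus (Fin 3) → Metric.sphere (0 : EuclideanSpace ℝ (Fin 3)) 1 → ℝ),
    Continuous (Function.uncurry Yf) → (∀ x ω, |Yf x ω| ≤ Yb) →
    ∀ (κ : UnitAddTorus (Fin 3) → EuclideanSpace ℝ (Fin 3) → ℝ), Continuous (Function.uncurry κ) → ∀ (C : ℝ),
    (∀ x v, |κ x v| ≤ C * (1 + ‖v‖ ^ 2)) →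
    (∀ x x' v v', |κ x v - κ x' v'| ≤ C * (1 + ‖v‖ ^ 2 + ‖v'‖ ^ 2) * (dist x x' + ‖v - v'‖)) →
    ∀ (ε : ℝ), 0 ≤ ε → ε ≤ 1 →
    |∫ x : UnitAddTorus (Fin 3), ∫ v : EuclideanSpace ℝ (Fin 3),
        ρ₀ x * Literature.Analysis.FluidPDE.localMaxwellian 1 (θ₀ x) (u₀ x) v *
        ∫ ω : Metric.sphere (0 : EuclideanSpace ℝ (Fin 3)) 1, (∫ w : EuclideanSpace ℝ (Fin 3),
          max (inner ℝ (v - w) ω) 0 * Yf x ω *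
          (ρ₀ ((Literature.Analysis.FluidPDE.Torus.geometry (Fin 3)).translate x (ε • (ω : EuclideanSpace ℝ (Fin 3)))) *
            Literature.Analysis.FluidPDE.localMaxwellian 1
              (θ₀ ((Literature.Analysis.FluidPDE.Torus.geometry (Fin 3)).translate x (ε • (ω : EuclideanSpace ℝ (Fin 3)))))
              (u₀ ((Literature.Analysis.FluidPDE.Torus.geometry (Fin 3)).translate x (ε • (ω : EuclideanSpace ℝ (Fin 3))))) w) *
          (κ x (v - inner ℝ (v - w) ω • (ω : EuclideanSpace ℝ (Fin 3))) +
            κ ((Literature.Analysis.FluidPDE.Torus.geometry (Fin 3)).translate x (ε • (ω : EuclideanSpace ℝ (Fin 3))))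
              (w + inner ℝ (v - w) ω • (ω : EuclideanSpace ℝ (Fin 3))) -
            κ x v -
            κ ((Literature.Analysis.FluidPDE.Torus.geometry (Fin 3)).translate x (ε • (ω : EuclideanSpace ℝ (Fin 3)))) w))
        ∂Literature.MathematicalPhysics.KineticTheory.sphereMeasure| ≤ K * C * ε := by
  intro ρm R θm Θ U Lb Yb hρm hθm
  obtain ⟨Ks, hKs0, hKs⟩ := k2r_corrector_slice Θ U hθm
  haveI := isFiniteMeasure_sphereMeasure (E := V3)
  set S : ℝ := (sphereMeasure : Measure (sphere (0 : V3) 1)).real univ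
  refine ⟨|R| * (|Yb| * |R| * (Ks * (1 + 2 * |Lb|)) * S), by positivity, ?_⟩
  intro ρ₀ θ₀ u₀ hρc hθc huc hρb hθb hub hLip Yf hYc hYb κ hκc C hκb hκL ε hε0 _hε1
  have hC : 0 ≤ C := by
    have h := (abs_nonneg _).trans (hκb 0 0)
    simpa using h
  have hθpos : ∀ x, 0 < θ₀ x := fun x => hθm.trans_le (hθb x).1
  have hρabs : ∀ x, |ρ₀ x| ≤ |R| := fun x => by
    rw [abs_of_nonneg (hρm.le.trans (hρb x).1)]
    exact (hρb x).2.trans (le_abs_self R)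
  have hYabs : ∀ x ω, |Yf x ω| ≤ |Yb| := fun x ω => (hYb x ω).trans (le_abs_self _)
  -- Step 1: the slice bound for a fixed position `x` and direction `ω`
  have hslice : ∀ (x : T3) (ω : sphere (0 : V3) 1),
      |∫ v, localMaxwellian 1 (θ₀ x) (u₀ x) v * ∫ w, max ⟪v - w, (ω : V3)⟫_ℝ 0 *
          localMaxwellian 1 (θ₀ ((Torus.geometry (Fin 3)).translate x (ε • (ω : V3))))
            (u₀ ((Torus.geometry (Fin 3)).translate x (ε • (ω : V3)))) w *
          (κ x (v - ⟪v - w, (ω : V3)⟫_ℝ • (ω : V3)) +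
            κ ((Torus.geometry (Fin 3)).translate x (ε • (ω : V3))) (w + ⟪v - w, (ω : V3)⟫_ℝ • (ω : V3)) -
            κ x v - κ ((Torus.geometry (Fin 3)).translate x (ε • (ω : V3))) w)| ≤
        Ks * (1 + 2 * |Lb|) * C * ε := by
    intro x ω
    set y : T3 := (Torus.geometry (Fin 3)).translate x (ε • (ω : V3))
    have hκ₁c : Continuous (κ x) := hκc.comp (Continuous.prodMk_right x)
    have hκ₂c : Continuous (κ y) := hκc.comp (Continuous.prodMk_right y)
    have hκ₁L : ∀ v v', |κ x v - κ x v'| ≤ C * (1 + ‖v‖ ^ 2 + ‖v'‖ ^ 2) * ‖v - v'‖ := fun v v' => by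
      have h := hκL x x v v'
      rwa [dist_self, zero_add] at h
    have hκ₁₂ : ∀ v, |κ x v - κ y v| ≤ C * (1 + ‖v‖ ^ 2 + ‖v‖ ^ 2) * dist x y := fun v => by
      have h := hκL x y v v
      rwa [sub_self, norm_zero, add_zero] at h
    have h := hKs (θ₀ x) (θ₀ y) (u₀ x) (u₀ y) (hθb x).1 (hθb x).2 (hθb y).1 (hθb y).2 (hub x) (hub y)
      ω (κ x) (κ y) hκ₁c hκ₂c C (dist x y) dist_nonneg (hκb x) (hκb y) hκ₁L hκ₁₂
    refine h.trans ?_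
    obtain ⟨-, hθL, huL⟩ := hLip x y
    have hd : dist x y ≤ ε := k2r_dist_translate_smul_le x ω hε0
    have hLbd : Lb * dist x y ≤ |Lb| * ε :=
      (mul_le_mul_of_nonneg_right (le_abs_self Lb) dist_nonneg).trans
        (mul_le_mul_of_nonneg_left hd (abs_nonneg Lb))
    have hsum : dist x y + |θ₀ x - θ₀ y| + ‖u₀ x - u₀ y‖ ≤ (1 + 2 * |Lb|) * ε := by linarith
    calc Ks * C * (dist x y + |θ₀ x - θ₀ y| + ‖u₀ x - u₀ y‖) ≤ Ks * C * ((1 + 2 * |Lb|) * ε) :=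
          mul_le_mul_of_nonneg_left hsum (mul_nonneg hKs0 hC)
      _ = Ks * (1 + 2 * |Lb|) * C * ε := by ring
  -- Step 2: the position slices
  have hpos : ∀ x : T3,
      |∫ v, ρ₀ x * localMaxwellian 1 (θ₀ x) (u₀ x) v *
        ∫ ω : sphere (0 : V3) 1, (∫ w, max ⟪v - w, (ω : V3)⟫_ℝ 0 * Yf x ω *
          (ρ₀ ((Torus.geometry (Fin 3)).translate x (ε • (ω : V3))) *
            localMaxwellian 1 (θ₀ ((Torus.geometry (Fin 3)).translate x (ε • (ω : V3))))
              (u₀ ((Torus.geometry (Fin 3)).translate x (ε • (ω : V3)))) w) *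
          (κ x (v - ⟪v - w, (ω : V3)⟫_ℝ • (ω : V3)) +
            κ ((Torus.geometry (Fin 3)).translate x (ε • (ω : V3))) (w + ⟪v - w, (ω : V3)⟫_ℝ • (ω : V3)) -
            κ x v - κ ((Torus.geometry (Fin 3)).translate x (ε • (ω : V3))) w)) ∂sphereMeasure| ≤
        |R| * (|Yb| * |R| * (Ks * (1 + 2 * |Lb|) * C * ε) * S) := by
    intro x
    have h := k2r_corrector_position hρc hθc huc hρabs hθpos (fun x => (hθb x).2) hub hYc hYabs hκc hκb
      ε x (hslice x)
    exact h.trans (mul_le_mul_of_nonneg_right (hρabs x) (by positivity))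
  -- Step 3: the `x`-integral over the probability space `𝕋³`
  have h := norm_integral_le_of_norm_le_const (μ := (volume : Measure T3))
    (C := |R| * (|Yb| * |R| * (Ks * (1 + 2 * |Lb|) * C * ε) * S))
    (Eventually.of_forall fun x => by rw [Real.norm_eq_abs]; exact hpos x)
  rw [Real.norm_eq_abs, probReal_univ, mul_one] at h
  refine h.trans (le_of_eq ?_)
  ring
end Summit.AtomisticToContinuum.HydrodynamicLimit.Theorems.EnskogAdjointDuality

end
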